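/-
Copyright: the b2b-balaban cell (near-miss cell 7), T⁴-continuum fan-out, NE7b ROUND-2 swarm `t4-ne7b-formalise-*`
(seat leaf-07, gen 2), row S6f «window-drop steps in the zone calculus» of lineage t4-ne7b-p1's claim table
`LEAVES-NE7b.md` (R-OWNER-22-2 (U2)).  Part Ia.
Released under the licence of the surrounding project.
-/
import Summits.QuantumFields.BalabanUV.T4Continuum.Support.ZoneTorus
import Literature.MathematicalPhysics.QuantumFieldTheory.Balaban1983to89.B16SProfile

/-!
# History levels: the zone calculus indexed by the MODEL SCALE (window-drop steps), Ia — levels, deflator, model scale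

Summits-side support leaf of the T⁴-continuum cell (rung (B)+1 on a FINITE torus only; NOT infinite volume, NOT the
mass gap, NOT the Clay statement; NOT a proof of the spine estimate NE7b).  NE7b ROUND-2 swarm, row **S6f** of the
owner's claim table (R-OWNER-22-2 (U2), journal l.5911): the landed zone calculus (`ZoneTorus`, `ZoneReading`,
`HistoryShapeZones`, `HistoryZonesTolerant`) blocks the cube lattice by `L` at EVERY step (cells of step `t` = level-`t`
blocks, `n·L^{K−t}` a side).  In the run the large-field cubes of step `j` are `M R_j`-cubes with `R_j = L^{s_j}`
((2.5), `B14.IsRj`), so the physical cube lattice of step `j` is the level-`σ(j)` blocking, `σ(j) = j + s_j − s_K`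
(the MODEL SCALE, `levelOf`), and from `j` to `j + 1` it coarsens by `L^{σ(j+1) − σ(j)} = L^{1 + s_{j+1} − s_j}`
(`B16SProfile.qexp`∕`ratio`): by `L` at an ordinary step, by `1` at a (2.5)-WINDOW-DROP step (`s_{j+1} = s_j − 1`).  Until
this row the certified sub-class displayed `NoDropInLife` (no drop during a structure's life, so that `σ = id` there).

THE DIFFICULTY AND THE REPAIR (typed here; nothing of print asserted).  At a drop step a zone does NOT contract, so the
one-step law `ext (t+1) ≤ σ²·ext t + cS` of `ZoneExtentLaw.ZoneDyn` ∕ `HistoryZonesTolerant.ZoneDynC` fails there, and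
with it the affine law feeding the count.  Drop steps are ISOLATED (`B16SProfile.DropCtl.lag_two`: no two consecutive
no-gain steps — B16 p. 385 «the square root appears here, because for some steps we do not gain the scaling factor»,
derived from (2.7)∕(2.5) in `B16SProfile.dropCtl_of_27b`).  REPAIR = that square root: run the landed law at a rate
`σ` with `1 ≤ L·σ⁴` (i.e. `σ² ≥ L^{−1∕2}`; the chain only ever used `1∕L ≤ σ² < 1`) on the DEFLATED extent
`θ_t · diam`, where the DEFLATOR `θ_t` (`theta`) is `σ²` at the step right after a drop and `1` otherwise — it recovers
in one step because drops are isolated — and move `1∕θ_t ≤ σ⁻²` into the nearness RADIUS (`nearD`: the torus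
nearness `ZoneTorus.nearT` read at levels with radius `r∕θ_t`), where the root-position count pays
`(r∕θ_t + 1)^d ≤ σ^{−2d}·(r+1)^d`: a CONSTANT per merger, folded into `Kz`.  The blocking fibre at levels is free:
`Λ^{lv t − lv s} ≤ Λ^{t − s}` (`LevelFn.sub_le`).  NO credit is spent and NO threshold is needed (this replaces the
owner's sketch «surplus `≤ Λ′^{s_root − s_K}` absorbed by the birth credit above a threshold»).

WHAT THIS FILE PROVES ([folklore] bookkeeping on the lineage's OWN carriers; no `Prop` fact minted, no `[cite:]`
tag).  §1 **`LevelFn K lv`** (monotone, 1-Lipschitz, plateaus isolated, `lv t ≤ K` on `t ≤ K`), **`LevelFn.sub_le`**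
(the blocking fibre at levels is free: `lv t − lv s ≤ t − s`), `levelFn_id` (the drop-free model).  §2 the deflator
**`theta lv ϑ`** (`ϑ = σ²` in use): values in `{ϑ, 1}`, `= 1` AT a plateau step (`theta_eq_one_of_plateau`, by
isolation), `= ϑ` right AFTER one (`theta_succ_of_plateau`).  §3 the model scale **`levelOf s K`** from the window
exponents: **`levelFn_levelOf`** (⇐ stepwise non-increasing `s` on `[0,K]` + `B16SProfile.DropCtl s K`),
`levelOf_eq_self_of_noDrop` (the `NoDropInLife` junction: `σ = id` on a drop-free tail), `levelOf_succ_eq_iff` (a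
plateau IS a window drop), `windowExp_succ_le` (non-increasing `s` ⇐ (2.5)'s minimality + monotone couplings, by
`B14FlowStep.ineq27a_of_monotone`).  §4 `isScale_of_le` (a cell of scale `lv j ≥ j` is a cell of scale `j`: the socket's
`cell_mem` is unaffected).  §5 decided sanity.  Part Ib (`Support/HistoryLevelsTorus.lean`): the levelled nearness
`nearD`, its root-position counts and the torus multiplicity at levels; part II (`Support/HistoryZonesDrops.lean`): the
levelled tolerant reading `ZoneReadingD`, the dynamics of the deflated extent, admissibility, the count.

HONEST DEPENDENCY (cell): continuum YM on T⁴ ⇐ BetaPertH ∧ nine spine estimates (0/9 proved); BetaPertH ⇐ (D1) ∧ (D4)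
∧ CAP+tail; G-an2-4 gates asym, D1 and NE2/3/4.  This file changes none of it.
-/

open Finset
open Literature.MathematicalPhysics.QuantumFieldTheory.Balaban1983to89
open Summit.QuantumFields.BalabanUV.T4Continuum.ZoneTorus

namespace Summit.QuantumFields.BalabanUV.T4Continuum.HistoryZones

noncomputable section

/-! ## §1 Level functions -/

/-- **A LEVEL FUNCTION for the cutoff `K`**: the blocking level `lv t` of the step-`t` cube lattice is non-decreasing,
rises by at most one per step, its PLATEAU steps (`lv (t+1) = lv t` — the window drops) are isolated, and levels of
steps `≤ K` are `≤ K`.  The drop-free model is `lv = id`. [folklore] -/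
structure LevelFn (K : ℕ) (lv : ℕ → ℕ) : Prop where
  /-- non-decreasing -/
  mono : ∀ t, lv t ≤ lv (t + 1)
  /-- rises by at most one per step -/
  lip : ∀ t, lv (t + 1) ≤ lv t + 1
  /-- a plateau step is followed by a rise (no two consecutive window drops) -/
  isolated : ∀ t, lv (t + 1) = lv t → lv (t + 2) = lv (t + 1) + 1
  /-- levels of steps up to the cutoff do not exceed the cutoff -/
  le_K : ∀ t, t ≤ K → lv t ≤ K

namespace LevelFn

variable {K : ℕ} {lv : ℕ → ℕ}

/-- a level function is monotone [folklore] -/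
theorem monotone (h : LevelFn K lv) : Monotone lv := monotone_nat_of_le_succ h.mono

/-- `lv (s + k) ≤ lv s + k` [folklore] -/
theorem le_add (h : LevelFn K lv) (s k : ℕ) : lv (s + k) ≤ lv s + k := by
  induction k with
  | zero => simp
  | succ k ih =>
      calc lv (s + (k + 1)) = lv (s + k + 1) := rfl
        _ ≤ lv (s + k) + 1 := h.lip _
        _ ≤ lv s + (k + 1) := by omega

/-- **THE FIBRE AT LEVELS IS FREE**: `lv t − lv s ≤ t − s` (truncated subtraction, all `s, t`). [folklore] -/
theorem sub_le (h : LevelFn K lv) (s t : ℕ) : lv t - lv s ≤ t - s := by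
  rcases le_or_gt s t with hst | hts
  · obtain ⟨k, rfl⟩ := Nat.exists_eq_add_of_le hst
    have := h.le_add s k
    omega
  · have := h.monotone hts.le
    omega

/-- each step is a plateau or a unit rise [folklore] -/
theorem succ_eq_or (h : LevelFn K lv) (t : ℕ) : lv (t + 1) = lv t ∨ lv (t + 1) = lv t + 1 := by
  have h1 := h.mono t
  have h2 := h.lip t
  omega

/-- a plateau step is not preceded by a plateau step [folklore] -/
theorem not_plateau_pred (h : LevelFn K lv) {t : ℕ} (ht : lv (t + 2) = lv (t + 1)) : lv (t + 1) ≠ lv t :=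
  fun h' => by have := h.isolated t h'; omega

end LevelFn

/-- the drop-free model: the identity is a level function [folklore] -/
theorem levelFn_id (K : ℕ) : LevelFn K (fun t => t) :=
  ⟨fun t => Nat.le_succ t, fun _ => le_rfl, fun t h => absurd h (Nat.succ_ne_self t), fun _ ht => ht⟩

/-! ## §2 The deflator -/

/-- **THE DEFLATOR** of a level function: `ϑ` at a step immediately AFTER a plateau step, `1` otherwise (in use
`ϑ = σ²`: the extent's missing contraction at the plateau is booked one step late). [folklore] -/
def theta (lv : ℕ → ℕ) (ϑ : ℝ) : ℕ → ℝ
  | 0 => 1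
  | t + 1 => if lv (t + 1) = lv t then ϑ else 1

section Theta

variable {K : ℕ} {lv : ℕ → ℕ} {ϑ : ℝ}

/-- `θ 0 = 1` [folklore] -/
@[simp] theorem theta_zero : theta lv ϑ 0 = 1 := rfl

/-- the successor clause [folklore] -/
theorem theta_succ (t : ℕ) : theta lv ϑ (t + 1) = if lv (t + 1) = lv t then ϑ else 1 := rfl

/-- `θ t ∈ {ϑ, 1}` [folklore] -/
theorem theta_mem (t : ℕ) : theta lv ϑ t = ϑ ∨ theta lv ϑ t = 1 := by
  cases t with
  | zero => exact Or.inr rfl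
  | succ t => rw [theta_succ]; split_ifs <;> simp

/-- `θ ≤ 1` for `ϑ ≤ 1` [folklore] -/
theorem theta_le_one (hϑ : ϑ ≤ 1) (t : ℕ) : theta lv ϑ t ≤ 1 := by
  rcases theta_mem (lv := lv) (ϑ := ϑ) t with h | h <;> simp [h, hϑ]

/-- `ϑ ≤ θ` for `ϑ ≤ 1` [folklore] -/
theorem le_theta (hϑ : ϑ ≤ 1) (t : ℕ) : ϑ ≤ theta lv ϑ t := by
  rcases theta_mem (lv := lv) (ϑ := ϑ) t with h | h <;> simp [h, hϑ]

/-- `0 < θ` for `0 < ϑ ≤ 1` [folklore] -/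
theorem theta_pos (hϑ : 0 < ϑ) (hϑ1 : ϑ ≤ 1) (t : ℕ) : 0 < theta lv ϑ t := hϑ.trans_le (le_theta hϑ1 t)

/-- AT a plateau step the deflator is `1` (plateaus are isolated) [folklore] -/
theorem theta_eq_one_of_plateau (h : LevelFn K lv) {t : ℕ} (ht : lv (t + 1) = lv t) : theta lv ϑ t = 1 := by
  cases t with
  | zero => rfl
  | succ t => rw [theta_succ, if_neg (h.not_plateau_pred ht)]

/-- right AFTER a plateau step the deflator is `ϑ` [folklore] -/
theorem theta_succ_of_plateau {t : ℕ} (ht : lv (t + 1) = lv t) : theta lv ϑ (t + 1) = ϑ := by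
  rw [theta_succ, if_pos ht]

/-- right after a rise the deflator is `1` [folklore] -/
theorem theta_succ_of_ne {t : ℕ} (ht : lv (t + 1) ≠ lv t) : theta lv ϑ (t + 1) = 1 := by
  rw [theta_succ, if_neg ht]

/-- the drop-free model has no deflation [folklore] -/
theorem theta_id (ϑ : ℝ) (t : ℕ) : theta (fun u => u) ϑ t = 1 := by
  cases t with
  | zero => rfl
  | succ t => rw [theta_succ, if_neg (Nat.succ_ne_self t)]

end Theta

/-! ## §3 The model scale from the window exponents -/

/-- **THE MODEL SCALE** of step `t` in a run with cutoff `K` and window exponents `s` (`R_j = L^{s_j}`, (2.5)):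
`σ(t) = t + s_{min t K} − s_K` — the blocking level of the step-`t` cube lattice when the step-`K` one is level `K`
(steps beyond the cutoff continue the unit rise). [folklore] -/
def levelOf (s : ℕ → ℕ) (K t : ℕ) : ℕ := t + s (min t K) - s K

section LevelOf

variable {s : ℕ → ℕ} {K : ℕ}

/-- below the cutoff [folklore] -/
theorem levelOf_of_le {t : ℕ} (ht : t ≤ K) : levelOf s K t = t + s t - s K := by
  rw [levelOf, min_eq_left ht]

/-- beyond the cutoff [folklore] -/
theorem levelOf_of_ge {t : ℕ} (ht : K ≤ t) : levelOf s K t = t := by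
  rw [levelOf, min_eq_right ht, Nat.add_sub_cancel]

/-- at the cutoff the model scale is the step [folklore] -/
@[simp] theorem levelOf_K : levelOf s K K = K := levelOf_of_ge le_rfl

/-- a stepwise non-increasing exponent is non-increasing on `[0, K]` [folklore] -/
theorem windowExp_le_of_le (hs : ∀ t, t < K → s (t + 1) ≤ s t) {u v : ℕ} (huv : u ≤ v) (hv : v ≤ K) :
    s v ≤ s u := by
  induction v, huv using Nat.le_induction with
  | base => exact le_rfl
  | succ v huv ih => exact (hs v (by omega)).trans (ih (by omega))

/-- under drop control the exponent falls by at most one per step: `s u ≤ s K + (K − u)` [folklore] -/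
theorem windowExp_le_add (hdrop : B16SProfile.DropCtl s K) : ∀ (k u : ℕ), u + k = K → s u ≤ s K + k
  | 0, u, h => by subst h; simp
  | k + 1, u, h => by
      have h1 := hdrop.lag_one (show u + 1 ≤ K by omega)
      have h2 := windowExp_le_add hdrop k (u + 1) (by omega)
      omega

/-- **THE MODEL SCALE IS A LEVEL FUNCTION** when the window exponent is stepwise non-increasing on `[0, K]`
(monotone couplings, `windowExp_succ_le`) and drop-controlled (`B16SProfile.DropCtl s K`, from (2.7)∕(2.5) by
`B16SProfile.dropCtl_of_27b`): plateaus = window drops, isolated by `DropCtl.lag_two`. [folklore] -/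
theorem levelFn_levelOf (hs : ∀ t, t < K → s (t + 1) ≤ s t) (hdrop : B16SProfile.DropCtl s K) :
    LevelFn K (levelOf s K) := by
  have hK : ∀ t, t ≤ K → s K ≤ s t := fun t ht => windowExp_le_of_le hs ht le_rfl
  refine ⟨fun t => ?_, fun t => ?_, fun t ht => ?_, fun t ht => ?_⟩
  · rcases lt_or_ge t K with htK | htK
    · have ht1 : t + 1 ≤ K := by omega
      rw [levelOf_of_le htK.le, levelOf_of_le ht1]
      have h1 : s t ≤ s (t + 1) + 1 := hdrop.lag_one ht1
      have h2 : s K ≤ s (t + 1) := hK (t + 1) ht1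
      omega
    · rw [levelOf_of_ge htK, levelOf_of_ge (by omega : K ≤ t + 1)]
      omega
  · rcases lt_or_ge t K with htK | htK
    · have ht1 : t + 1 ≤ K := by omega
      rw [levelOf_of_le htK.le, levelOf_of_le ht1]
      have h1 : s (t + 1) ≤ s t := hs t htK
      have h2 : s K ≤ s (t + 1) := hK (t + 1) ht1
      omega
    · rw [levelOf_of_ge htK, levelOf_of_ge (by omega : K ≤ t + 1)]
  · rcases lt_or_ge t K with htK | htK
    · have ht1 : t + 1 ≤ K := by omega
      rw [levelOf_of_le htK.le, levelOf_of_le ht1] at ht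
      have h2 : s K ≤ s (t + 1) := hK (t + 1) ht1
      have h3 : s K ≤ s t := hK t htK.le
      rcases lt_or_ge (t + 1) K with ht1' | ht1'
      · have ht2 : t + 2 ≤ K := by omega
        rw [levelOf_of_le ht2, levelOf_of_le ht1]
        have h4 : s t ≤ s (t + 2) + 1 := hdrop.lag_two ht2
        have h5 : s (t + 2) ≤ s (t + 1) := hs (t + 1) ht1'
        have h6 : s K ≤ s (t + 2) := hK (t + 2) ht2
        omega
      · rw [levelOf_of_ge (by omega : K ≤ t + 2), levelOf_of_ge (by omega : K ≤ t + 1)]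
    · rw [levelOf_of_ge htK, levelOf_of_ge (by omega : K ≤ t + 1)] at ht
      omega
  · rw [levelOf_of_le ht]
    have h1 : s t ≤ s K + (K - t) := windowExp_le_add hdrop (K - t) t (by omega)
    omega

/-- the model scale is at least the step on `[0, K]` [folklore] -/
theorem le_levelOf (hs : ∀ t, t < K → s (t + 1) ≤ s t) (t : ℕ) : t ≤ levelOf s K t := by
  rcases le_or_gt t K with ht | ht
  · rw [levelOf_of_le ht]
    have := windowExp_le_of_le hs ht le_rfl
    omega
  · rw [levelOf_of_ge ht.le]

/-- **THE `NoDropInLife` JUNCTION**: on a drop-free tail `[t, K]` (`s` constant there) the model scale is the step.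
[folklore] -/
theorem levelOf_eq_self_of_noDrop {t : ℕ} (h : ∀ u, t ≤ u → u ≤ K → s u = s K) : levelOf s K t = t := by
  rcases le_or_gt t K with ht | ht
  · rw [levelOf_of_le ht, h t le_rfl ht, Nat.add_sub_cancel]
  · rw [levelOf_of_ge ht.le]

/-- a plateau of the model scale below the cutoff IS a window drop [folklore] -/
theorem levelOf_succ_eq_iff (hs : ∀ t, t < K → s (t + 1) ≤ s t) (hdrop : B16SProfile.DropCtl s K) {t : ℕ}
    (ht : t < K) : levelOf s K (t + 1) = levelOf s K t ↔ s (t + 1) + 1 = s t := by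
  have ht1 : t + 1 ≤ K := by omega
  rw [levelOf_of_le ht.le, levelOf_of_le ht1]
  have h1 : s t ≤ s (t + 1) + 1 := hdrop.lag_one ht1
  have h2 : s K ≤ s (t + 1) := windowExp_le_of_le hs ht1 le_rfl
  have h3 : s K ≤ s t := windowExp_le_of_le hs ht.le le_rfl
  omega

/-- **NON-INCREASING WINDOW EXPONENTS FROM MONOTONE COUPLINGS**: with (2.5) and its minimality at every step `≤ K`
(`R_n = L^{s_n}` the least power of `L` above `(log g_n⁻²)^r`, the binder shape of `B16SProfile.dropCtl_of_27b`) and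
couplings `0 < g_t ≤ g_{t+1} ≤ 1`, the exponent does not increase: `s_{t+1} ≤ s_t`
(`B14FlowStep.ineq27a_of_monotone`). [folklore] -/
theorem windowExp_succ_le {L r : ℕ} {g : ℕ → ℝ} {R : ℕ → ℕ}
    (hR : ∀ n, n ≤ K → R n = L ^ s n ∧ (Real.log ((g n) ^ 2)⁻¹) ^ r ≤ (R n : ℝ) ∧
      ∀ s' : ℕ, (Real.log ((g n) ^ 2)⁻¹) ^ r ≤ ((L ^ s' : ℕ) : ℝ) → s n ≤ s')
    (hpos : ∀ n, n ≤ K → 0 < g n) (hle1 : ∀ n, n ≤ K → g n ≤ 1) (hmono : ∀ n, n < K → g n ≤ g (n + 1)) :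
    ∀ t, t < K → s (t + 1) ≤ s t := by
  intro t ht
  obtain ⟨hRt, hlt, -⟩ := hR t ht.le
  obtain ⟨-, -, hmin⟩ := hR (t + 1) (Nat.succ_le_of_lt ht)
  refine hmin (s t) ?_
  calc (Real.log ((g (t + 1)) ^ 2)⁻¹) ^ r ≤ (Real.log ((g t) ^ 2)⁻¹) ^ r :=
        B14FlowStep.ineq27a_of_monotone (hpos t ht.le) (hle1 (t + 1) (Nat.succ_le_of_lt ht)) (hmono t ht)
    _ ≤ (R t : ℝ) := hlt
    _ = ((L ^ s t : ℕ) : ℝ) := by rw [hRt]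

end LevelOf

/-! ## §4 Scale monotonicity (the socket's `cell_mem` is unaffected) -/

variable {d : ℕ} in

/-- a cell of scale `u` is a cell of every scale `j ≤ u` — so a root cell read at the model scale `lv j ≥ j` is still a
cell of scale `j` (`HistorySocketTH`'s `cell_mem`). [folklore] -/
theorem isScale_of_le {N L j u : ℕ} (h : j ≤ u) {x : TCell d N} (hx : IsScale L u x) : IsScale L j x :=
  fun i => (pow_dvd_pow L h).trans (hx i)

/-! ## §5 Sanity (decided ∕ closed instances) -/

namespace SanityD

/-- window exponents `3,3,2,2,1,1` (cutoff `K = 5`): model scales `2,3,3,4,4,5,6` — two isolated plateaus -/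
example : (List.range 7).map (levelOf (fun t => [3, 3, 2, 2, 1, 1].getD t 1) 5) = [2, 3, 3, 4, 4, 5, 6] := by decide

/-- the deflator of that run: `ϑ` at the step `2` right after the plateau `1 → 2` (window drop `s₂ = s₁ − 1`) … -/
example (ϑ : ℝ) : theta (levelOf (fun t => [3, 3, 2, 2, 1, 1].getD t 1) 5) ϑ 2 = ϑ :=
  theta_succ_of_plateau (by decide)

/-- … and `1` at the step `3` right after the rise `2 → 3` -/
example (ϑ : ℝ) : theta (levelOf (fun t => [3, 3, 2, 2, 1, 1].getD t 1) 5) ϑ 3 = 1 :=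
  theta_succ_of_ne (by decide)

end SanityD

end

end Summit.QuantumFields.BalabanUV.T4Continuum.HistoryZones
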